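import Mathlib
import Summits.BirchSwinnertonDyer.BirchSwinnertonDyer.Theorems.KatoDescentTamePotSupersingularTameLowerFibreAdjointBricksFiveFrattini

/-!
# Bricks for the `GL₂(𝔽₅)`-lifting route (T5′), VI: residual image `GL₂(𝔽₅)` fills `S^μ(ℤ/5^{m+1})`

Continuation of `…TameLowerFibreAdjointBricksFive{,Det,Inflation,Smu,Frattini}` (same namespace).
`smu_mem_of_forall_exists_map_castHom_five_eq`: for every `m ≥ 0`, a subgroup `H ≤ GL₂(ℤ/5^{m+1})`
all of whose elements have `det⁴ = 1` and whose reduction modulo `5` covers `GL₂(𝔽₅)` contains every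
`g` with `(det g)⁴ = 1`, i.e. `H = S^μ(ℤ/5^{m+1})`. Induction along the tower: the image of `H` in
`GL₂(ℤ/5^{m+1})` is `S^μ(ℤ/5^{m+1})` by the induction hypothesis, and then the layer theorem
`smu_mem_of_forall_exists_map_eq` (file V) lifts this to level `m + 2`; the base `m = 0` is the
injectivity of `GL₂(ℤ/5^1) → GL₂(ℤ/5)`.

This is the lifting statement (T5′) of ARM-P audit r07 S7 ADDENDUM-1 §C for the UNRAMIFIED
coefficient ring `A = ℤ₅` at every finite level `ℤ/5^{m+1}`: a closed subgroup of `S^μ(ℤ₅)` with residual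
image `GL₂(𝔽₅)` is `S^μ(ℤ₅)`, hence contains `SL₂(ℤ₅)` (for RATIONAL members of the ordinary fibre this
is Serre, *Abelian ℓ-adic representations*, IV-23 Lemma 3 and its exercise; the dossier's gap Δ1 at
`p = 5` concerns NON-rational members, `A = 𝒪_𝔭 ≠ ℤ₅`, whose ramified / residue-extension layers of
(P′) are not covered by files V–VI). Route-free, no definitions, nothing about elliptic curves or
items 19618/19981 (open). Target T-S7r07-1 (`FibreLatticeInput 5`).
-/

set_option linter.dupNamespace false

open Matrix

namespace Summit.BirchSwinnertonDyer.BirchSwinnertonDyer.Theorems.GL2F5AdjointBricks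

section tower

/-- **(T5′) for `A = ℤ₅`, every finite level.** Let `H ≤ GL₂(ℤ/5^{m+1})` be a subgroup with
`(det h)⁴ = 1` for all `h ∈ H` whose reduction modulo `5` hits every element of `GL₂(𝔽₅)`. Then every
`g ∈ GL₂(ℤ/5^{m+1})` with `(det g)⁴ = 1` lies in `H` (`H = S^μ(ℤ/5^{m+1}) ⊇ SL₂(ℤ/5^{m+1})`). -/
theorem smu_mem_of_forall_exists_map_castHom_five_eq (m : ℕ)
    (H : Subgroup (GL (Fin 2) (ZMod (5 ^ (m + 1)))))
    (hHμ : ∀ h ∈ H, Matrix.det (h : Matrix (Fin 2) (Fin 2) (ZMod (5 ^ (m + 1)))) ^ 4 = 1)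
    (hsurj : ∀ q : GL (Fin 2) (ZMod 5),
      ∃ h ∈ H, Matrix.GeneralLinearGroup.map (ZMod.castHom (dvd_pow_self 5 (Nat.succ_ne_zero m)) (ZMod 5)) h = q)
    (g : GL (Fin 2) (ZMod (5 ^ (m + 1))))
    (hg : Matrix.det (g : Matrix (Fin 2) (Fin 2) (ZMod (5 ^ (m + 1)))) ^ 4 = 1) : g ∈ H := by
  induction m with
  | zero =>
    -- level `5^1`: reduction to `ℤ/5` is injective
    haveI : NeZero (5 ^ (0 + 1)) := ⟨by norm_num⟩
    set c5 := ZMod.castHom (dvd_pow_self 5 (Nat.succ_ne_zero 0)) (ZMod 5) with hc5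
    set ρ := Matrix.GeneralLinearGroup.map (n := Fin 2) c5 with hρ
    have h51 : 5 ^ (0 + 1) ∣ 5 := by norm_num
    set e := ZMod.castHom h51 (ZMod (5 ^ (0 + 1))) with he
    set σ := Matrix.GeneralLinearGroup.map (n := Fin 2) e with hσ
    have hec : e.comp c5 = RingHom.id _ := Subsingleton.elim _ _
    have hσρ : ∀ x, σ (ρ x) = x := by
      intro x
      have h : Matrix.GeneralLinearGroup.map (n := Fin 2) (e.comp c5) x = x := by
        rw [hec, Matrix.GeneralLinearGroup.map_id]; rfl
      rw [Matrix.GeneralLinearGroup.map_comp] at h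
      exact h
    obtain ⟨h, hhH, hh⟩ := hsurj (ρ g)
    have : h = g := by rw [← hσρ h, ← hσρ g]; exact congrArg σ hh
    exact this ▸ hhH
  | succ m ih =>
    haveI : NeZero (5 ^ (m + 1 + 1)) := ⟨pow_ne_zero _ (by norm_num)⟩
    haveI : NeZero (5 ^ (m + 1)) := ⟨pow_ne_zero _ (by norm_num)⟩
    set c5 := ZMod.castHom (dvd_pow_self 5 (Nat.succ_ne_zero (m + 1))) (ZMod 5) with hc5
    set cm := ZMod.castHom (pow_dvd_pow 5 (m + 1).le_succ) (ZMod (5 ^ (m + 1))) with hcm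
    set c5' := ZMod.castHom (dvd_pow_self 5 (Nat.succ_ne_zero m)) (ZMod 5) with hc5'
    set ρ := Matrix.GeneralLinearGroup.map (n := Fin 2) c5 with hρ
    set red := Matrix.GeneralLinearGroup.map (n := Fin 2) cm with hred
    set ρ' := Matrix.GeneralLinearGroup.map (n := Fin 2) c5' with hρ'
    have hcomp : c5'.comp cm = c5 := Subsingleton.elim _ _
    have hρred : ∀ x, ρ' (red x) = ρ x := by
      intro x
      have h : Matrix.GeneralLinearGroup.map (n := Fin 2) (c5'.comp cm) x = ρ x := by rw [hcomp]
      rw [Matrix.GeneralLinearGroup.map_comp] at h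
      exact h
    have hμ_red : ∀ x : GL (Fin 2) (ZMod (5 ^ (m + 1 + 1))),
        Matrix.det (x : Matrix (Fin 2) (Fin 2) (ZMod (5 ^ (m + 1 + 1)))) ^ 4 = 1 →
        Matrix.det ((red x : GL (Fin 2) (ZMod (5 ^ (m + 1)))) : Matrix (Fin 2) (Fin 2) (ZMod (5 ^ (m + 1)))) ^ 4 = 1 := by
      intro x hx
      have hd : Matrix.det ((red x : GL (Fin 2) (ZMod (5 ^ (m + 1)))) : Matrix (Fin 2) (Fin 2) (ZMod (5 ^ (m + 1)))) =
          cm (Matrix.det (x : Matrix (Fin 2) (Fin 2) (ZMod (5 ^ (m + 1 + 1))))) := by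
        rw [RingHom.map_det]; congr 1
      rw [hd, ← map_pow, hx, map_one]
    -- the image of `H` one level down is `S^μ(ℤ/5^{m+1})` by induction
    have hH' : ∀ q : GL (Fin 2) (ZMod (5 ^ (m + 1))),
        Matrix.det (q : Matrix (Fin 2) (Fin 2) (ZMod (5 ^ (m + 1)))) ^ 4 = 1 → q ∈ H.map red := by
      intro q hq
      refine ih (H.map red) ?_ ?_ q hq
      · intro h' hh'
        obtain ⟨h, hh, rfl⟩ := Subgroup.mem_map.1 hh'
        exact hμ_red h (hHμ h hh)
      · intro q₀
        obtain ⟨h, hh, hhq⟩ := hsurj q₀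
        exact ⟨red h, Subgroup.mem_map_of_mem red hh, by rw [hρred, hhq]⟩
    -- hence `H` covers `S^μ(ℤ/5^{m+1})`, and the layer theorem applies
    refine smu_mem_of_forall_exists_map_eq (m + 1) (by omega) H hHμ ?_ g hg
    intro q hq
    obtain ⟨h, hh, hhq⟩ := Subgroup.mem_map.1 (hH' q hq)
    exact ⟨h, hh, hhq⟩

end tower

end Summit.BirchSwinnertonDyer.BirchSwinnertonDyer.Theorems.GL2F5AdjointBricks
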